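import Mathlib
import HarnessLib
import Literature.Analysis.OperatorTheory.L2KernelIntegralOperator
import Summits.RiemannHypothesis.RiemannHypothesis.Theorems.SuzukiWindowsDoorPlumbing

/-!
# SuzukiWindowsDoor — crux A1, file 2/3: the operator path `t ↦ 𝖪[t]` (RH-FREE, ζ-FREE)

`stub_opPath` of the registered LINE «plumbing» of route item stmt-RiemannHypothesis-19732: for a continuous real
kernel `K`, the truncated Hankel operators `(𝖪[t]f)(x) = 1_{(−t,t)}(x) ∫_{(−t,t)} K(x+y) f(y) dy` are realised on
`Lp ℝ 2 volume` through the tree's `Literature.Analysis.OperatorTheory.L2KernelIntegralOperator` (square-integrable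
kernel `1_{(−t,t)²}(x,y) K(x+y)`; Reed–Simon I, Thm. VI.23): bounded, compact, self-adjoint, `𝖪[0] = 0`, and
OPERATOR-NORM CONTINUOUS in `t` by the Hilbert–Schmidt bound `‖𝖪[t'] − 𝖪[t]‖² ≤ ∫∫ (k_{t'} − k_t)² ≤ M²((2t')² − (2t)²)`
(nested windows, `M` a bound of `|K|` on the doubled window).  Main statement: `…Cruxes.WindowsImplyContraction.Plumbing.stub_opPath` (exact registered signature and name); helpers in
`…Theorems.SuzukiWindowsDoorOpPath`. Planner rh-dbr-theory g5's farm-verified file 2/3, ported by rh-dbr-eng g3.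
Cell pub-rh-dbr, column DBR.  RH-FREE operator theory; nothing here bears on the truth of RH.
-/

set_option linter.dupNamespace false

open MeasureTheory Set Filter Function
open scoped ENNReal Topology

/-! ## The operator path (stub_opPath) -/


namespace Summit.RiemannHypothesis.RiemannHypothesis.Theorems.SuzukiWindowsDoorOpPath

/-- The truncated Hankel kernel `k_t(x,y) = 1_{(−t,t)²}(x,y) K(x+y)`. -/
noncomputable def opKernel (K : ℝ → ℝ) (t : ℝ) : ℝ → ℝ → ℝ :=
  fun x y => (Ioo (-t) t ×ˢ Ioo (-t) t).indicator (fun p : ℝ × ℝ => K (p.1 + p.2)) (x, y)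

variable {K : ℝ → ℝ}

/-- Uncurried form of the window kernel: the indicator of the square window times `K (x + y)`. -/
theorem uncurry_opKernel (K : ℝ → ℝ) (t : ℝ) :
    uncurry (opKernel K t) = (Ioo (-t) t ×ˢ Ioo (-t) t).indicator (fun p : ℝ × ℝ => K (p.1 + p.2)) := by
  funext p; rfl

/-- Inside the square window the kernel is `K (x + y)`. -/
theorem opKernel_of_mem {t x y : ℝ} (hx : x ∈ Ioo (-t) t) (hy : y ∈ Ioo (-t) t) :
    opKernel K t x y = K (x + y) := by
  unfold opKernel; rw [indicator_of_mem (mk_mem_prod hx hy)]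

/-- The window kernel vanishes when the first variable is outside the window. -/
theorem opKernel_of_not_mem_left {t x y : ℝ} (hx : x ∉ Ioo (-t) t) : opKernel K t x y = 0 := by
  unfold opKernel; rw [indicator_of_notMem]; exact fun h => hx (mem_prod.mp h).1

/-- The window kernel vanishes when the second variable is outside the window. -/
theorem opKernel_of_not_mem_right {t x y : ℝ} (hy : y ∉ Ioo (-t) t) : opKernel K t x y = 0 := by
  unfold opKernel; rw [indicator_of_notMem]; exact fun h => hy (mem_prod.mp h).2

/-- The window kernel is symmetric (Hankel kernel `K (x + y)` on a symmetric window). -/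
theorem opKernel_symm (K : ℝ → ℝ) (t x y : ℝ) : opKernel K t x y = opKernel K t y x := by
  by_cases hx : x ∈ Ioo (-t) t
  · by_cases hy : y ∈ Ioo (-t) t
    · rw [opKernel_of_mem hx hy, opKernel_of_mem hy hx, add_comm]
    · rw [opKernel_of_not_mem_right hy, opKernel_of_not_mem_left hy]
  · rw [opKernel_of_not_mem_left hx, opKernel_of_not_mem_right hx]

/-- As a function of `y`, the kernel is an indicator times a translate of `K`. -/
theorem opKernel_eq_indicator (K : ℝ → ℝ) (t x : ℝ) :
    opKernel K t x = fun y => (Ioo (-t) t).indicator (fun _ => (1 : ℝ)) x *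
      (Ioo (-t) t).indicator (fun y => K (x + y)) y := by
  funext y
  by_cases hx : x ∈ Ioo (-t) t
  · by_cases hy : y ∈ Ioo (-t) t
    · rw [opKernel_of_mem hx hy, indicator_of_mem hx, indicator_of_mem hy, one_mul]
    · rw [opKernel_of_not_mem_right hy, indicator_of_notMem hy, mul_zero]
  · rw [opKernel_of_not_mem_left hx, indicator_of_notMem hx, zero_mul]

/-- Measurability of the window kernel in the second variable. -/
theorem measurable_opKernel_right (hK : Continuous K) (t x : ℝ) : Measurable (opKernel K t x) := by
  rw [opKernel_eq_indicator]
  exact (((hK.comp (continuous_const_add x)).measurable.indicator measurableSet_Ioo).const_mul _)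

/-- `sup |K|` over sums of two points of the window `(−T, T)`. -/
theorem exists_kernel_bound (hK : Continuous K) (T : ℝ) :
    ∃ M : ℝ, 0 ≤ M ∧ ∀ x ∈ Ioo (-T) T, ∀ y ∈ Ioo (-T) T, |K (x + y)| ≤ M := by
  obtain ⟨C, hC⟩ := (isCompact_Icc : IsCompact (Icc (-(2 * T)) (2 * T))).exists_bound_of_continuousOn
    hK.continuousOn
  refine ⟨max C 0, le_max_right _ _, fun x hx y hy => ?_⟩
  have hxy : x + y ∈ Icc (-(2 * T)) (2 * T) := by
    rw [mem_Ioo] at hx hy; constructor <;> linarith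
  have := hC _ hxy
  rw [Real.norm_eq_abs] at this
  exact this.trans (le_max_left _ _)

/-- The window kernel is bounded by a bound of `|K|` on the doubled window. -/
theorem abs_opKernel_le {t T M x y : ℝ} (htT : t ≤ T)
    (hM : ∀ x ∈ Ioo (-T) T, ∀ y ∈ Ioo (-T) T, |K (x + y)| ≤ M) (hM0 : 0 ≤ M) :
    |opKernel K t x y| ≤ M := by
  by_cases hx : x ∈ Ioo (-t) t
  · by_cases hy : y ∈ Ioo (-t) t
    · rw [opKernel_of_mem hx hy]
      exact hM x (Ioo_subset_Ioo (neg_le_neg htT) htT hx) y (Ioo_subset_Ioo (neg_le_neg htT) htT hy)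
    · rw [opKernel_of_not_mem_right hy, abs_zero]; exact hM0
  · rw [opKernel_of_not_mem_left hx, abs_zero]; exact hM0

/-- Lebesgue measure of the square window `(−t,t)²`. -/
theorem volume_prod_window (t : ℝ) :
    (volume.prod volume) (Ioo (-t) t ×ˢ Ioo (-t) t) = ENNReal.ofReal (2 * t) * ENNReal.ofReal (2 * t) := by
  rw [Measure.prod_prod, Real.volume_Ioo]; ring_nf

/-- The kernel is square-integrable on `ℝ × ℝ`. -/
theorem memLp_opKernel (hK : Continuous K) (t : ℝ) :
    MemLp (uncurry (opKernel K t)) 2 ((volume : Measure ℝ).prod volume) := by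
  rw [uncurry_opKernel, memLp_indicator_iff_restrict (measurableSet_Ioo.prod measurableSet_Ioo)]
  haveI : IsFiniteMeasure (((volume : Measure ℝ).prod volume).restrict (Ioo (-t) t ×ˢ Ioo (-t) t)) :=
    ⟨by rw [Measure.restrict_apply_univ, volume_prod_window]
        exact ENNReal.mul_lt_top ENNReal.ofReal_lt_top ENNReal.ofReal_lt_top⟩
  obtain ⟨M, hM0, hM⟩ := exists_kernel_bound hK t
  refine MemLp.of_bound (hK.comp (continuous_fst.add continuous_snd)).aestronglyMeasurable M ?_
  refine ae_restrict_of_forall_mem (measurableSet_Ioo.prod measurableSet_Ioo) fun p hp => ?_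
  rw [Real.norm_eq_abs]
  exact hM p.1 (mem_prod.mp hp).1 p.2 (mem_prod.mp hp).2

/-- The kernel formula is the truncated Hankel integral. -/
theorem integral_opKernel_mul (K : ℝ → ℝ) (t x : ℝ) (f : ℝ → ℝ) :
    ∫ y, opKernel K t x y * f y = (Ioo (-t) t).indicator (fun x => ∫ y in Ioo (-t) t, K (x + y) * f y) x := by
  by_cases hx : x ∈ Ioo (-t) t
  · rw [indicator_of_mem hx, ← integral_indicator measurableSet_Ioo]
    refine integral_congr_ae (Eventually.of_forall fun y => ?_)
    show opKernel K t x y * f y = (Ioo (-t) t).indicator (fun y => K (x + y) * f y) y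
    by_cases hy : y ∈ Ioo (-t) t
    · rw [opKernel_of_mem hx hy, indicator_of_mem hy]
    · rw [opKernel_of_not_mem_right hy, indicator_of_notMem hy, zero_mul]
  · rw [indicator_of_notMem hx]
    simp [opKernel_of_not_mem_left hx]

/-- `y ↦ k_t(x,y) φ(y)` is integrable for every `x`. -/
theorem integrable_opKernel_mul (hK : Continuous K) (t x : ℝ) (φ : Lp ℝ 2 (volume : Measure ℝ)) :
    Integrable (fun y => opKernel K t x y * φ y) (volume : Measure ℝ) := by
  obtain ⟨M, hM0, hM⟩ := exists_kernel_bound hK t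
  have hφ : Integrable ((Ioo (-t) t).indicator (φ : ℝ → ℝ)) (volume : Measure ℝ) := by
    rw [integrable_indicator_iff measurableSet_Ioo]
    exact ((Lp.memLp φ).restrict (Ioo (-t) t)).integrable one_le_two
  have heq : (fun y => opKernel K t x y * φ y) =
      fun y => opKernel K t x y * (Ioo (-t) t).indicator (φ : ℝ → ℝ) y := by
    funext y
    by_cases hy : y ∈ Ioo (-t) t
    · rw [indicator_of_mem hy]
    · rw [opKernel_of_not_mem_right hy, zero_mul, zero_mul]
  rw [heq]
  exact hφ.bdd_mul (measurable_opKernel_right hK t x).aestronglyMeasurable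
    (Eventually.of_forall fun y => by rw [Real.norm_eq_abs]; exact abs_opKernel_le le_rfl hM hM0)

/-! ### The operator path -/

/-- Existence of the bounded operator on `L²(ℝ)` with the window kernel (Reed–Simon VI.23 via the tree). -/
theorem exists_op (hK : Continuous K) (t : ℝ) :
    ∃ A : Lp ℝ 2 (volume : Measure ℝ) →L[ℝ] Lp ℝ 2 (volume : Measure ℝ),
      ∀ φ : Lp ℝ 2 (volume : Measure ℝ), (A φ : ℝ → ℝ) =ᵐ[volume] fun x => ∫ y, opKernel K t x y * φ y :=
  Literature.Analysis.OperatorTheory.exists_l2KernelOp (memLp_opKernel hK t)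

/-- The operator `𝖪[t]` (a choice of the bounded operator with the kernel formula). -/
noncomputable def op (hK : Continuous K) (t : ℝ) :
    Lp ℝ 2 (volume : Measure ℝ) →L[ℝ] Lp ℝ 2 (volume : Measure ℝ) :=
  Classical.choose (exists_op hK t)

/-- The a.e. kernel formula for `𝖪[t] φ`. -/
theorem op_spec (hK : Continuous K) (t : ℝ) (φ : Lp ℝ 2 (volume : Measure ℝ)) :
    (op hK t φ : ℝ → ℝ) =ᵐ[volume] fun x => ∫ y, opKernel K t x y * φ y :=
  Classical.choose_spec (exists_op hK t) φ

/-- `𝖪[t] φ` is (a.e.) the window indicator times the window integral `∫_{(−t,t)} K(x+y) φ(y) dy`. -/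
theorem op_repr (hK : Continuous K) (t : ℝ) (φ : Lp ℝ 2 (volume : Measure ℝ)) :
    (op hK t φ : ℝ → ℝ) =ᵐ[volume]
      fun x => (Ioo (-t) t).indicator (fun x => ∫ y in Ioo (-t) t, K (x + y) * φ y) x :=
  (op_spec hK t φ).trans (Eventually.of_forall fun x => integral_opKernel_mul K t x φ)

/-- The empty window gives the zero operator: `𝖪[0] = 0`. -/
theorem op_zero (hK : Continuous K) : op hK 0 = 0 := by
  refine ContinuousLinearMap.ext fun φ => Lp.ext ?_
  filter_upwards [op_repr hK 0 φ, Lp.coeFn_zero ℝ 2 (volume : Measure ℝ)] with x hx h0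
  rw [hx, zero_apply, h0, Pi.zero_apply, indicator_of_notMem]
  simp

/-- `𝖪[t]` is self-adjoint (symmetric real kernel). -/
theorem isSelfAdjoint_op (hK : Continuous K) (t : ℝ) : IsSelfAdjoint (op hK t) :=
  Literature.Analysis.OperatorTheory.isSelfAdjoint_l2KernelOp (memLp_opKernel hK t)
    (opKernel_symm K t) (op_spec hK t)

/-- `𝖪[t]` is compact (Hilbert–Schmidt kernel). -/
theorem isCompactOperator_op (hK : Continuous K) (t : ℝ) : IsCompactOperator (op hK t) :=
  Literature.Analysis.OperatorTheory.isCompactOperator_l2KernelOp (memLp_opKernel hK t) (op_spec hK t)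

/-! ### Operator-norm continuity of the path -/

/-- The a.e. kernel formula for the difference `𝖪[t'] − 𝖪[t]`. -/
theorem op_sub_spec (hK : Continuous K) (t t' : ℝ) (φ : Lp ℝ 2 (volume : Measure ℝ)) :
    ((op hK t' - op hK t) φ : ℝ → ℝ) =ᵐ[volume]
      fun x => ∫ y, (opKernel K t' x y - opKernel K t x y) * φ y := by
  rw [sub_apply]
  filter_upwards [Lp.coeFn_sub (op hK t' φ) (op hK t φ), op_spec hK t' φ, op_spec hK t φ]
    with x hsub h1 h2
  rw [hsub, Pi.sub_apply, h1, h2,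
    ← integral_sub (integrable_opKernel_mul hK t' x φ) (integrable_opKernel_mul hK t x φ)]
  refine integral_congr_ae (Eventually.of_forall fun y => ?_)
  show opKernel K t' x y * φ y - opKernel K t x y * φ y = (opKernel K t' x y - opKernel K t x y) * φ y
  ring

/-- The difference of two window kernels is square-integrable on `ℝ²`. -/
theorem memLp_opKernel_sub (hK : Continuous K) (t t' : ℝ) :
    MemLp (uncurry fun x y => opKernel K t' x y - opKernel K t x y) 2 ((volume : Measure ℝ).prod volume) := by
  have : (uncurry fun x y => opKernel K t' x y - opKernel K t x y) =
      uncurry (opKernel K t') - uncurry (opKernel K t) := rfl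
  rw [this]
  exact (memLp_opKernel hK t').sub (memLp_opKernel hK t)

/-- Hilbert–Schmidt bound for the difference of two operators of the path. -/
theorem norm_op_sub_le (hK : Continuous K) (t t' : ℝ) :
    ‖op hK t' - op hK t‖ ≤ Real.sqrt
      (∫ z, (opKernel K t' z.1 z.2 - opKernel K t z.1 z.2) ^ 2 ∂((volume : Measure ℝ).prod volume)) := by
  refine ContinuousLinearMap.opNorm_le_bound _ (Real.sqrt_nonneg _) fun φ => ?_
  have hD := memLp_opKernel_sub hK t t'
  have h := Literature.Analysis.OperatorTheory.integral_sq_integral_l2Kernel_mul_le hD φ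
  have hsq : ‖(op hK t' - op hK t) φ‖ ^ 2 =
      ∫ x, (∫ y, (opKernel K t' x y - opKernel K t x y) * φ y) ^ 2 := by
    rw [Summit.RiemannHypothesis.RiemannHypothesis.Cruxes.WindowsImplyContraction.Plumbing.norm_sq_eq_integral_sq]
    refine integral_congr_ae ?_
    filter_upwards [op_sub_spec hK t t' φ] with x hx
    simp only [hx]
  have h2 : ‖(op hK t' - op hK t) φ‖ ^ 2 ≤
      (∫ z, (opKernel K t' z.1 z.2 - opKernel K t z.1 z.2) ^ 2 ∂((volume : Measure ℝ).prod volume)) *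
        ‖φ‖ ^ 2 := by
    rw [hsq]; exact h
  calc ‖(op hK t' - op hK t) φ‖ = Real.sqrt (‖(op hK t' - op hK t) φ‖ ^ 2) :=
        (Real.sqrt_sq (norm_nonneg _)).symm
    _ ≤ Real.sqrt ((∫ z, (opKernel K t' z.1 z.2 - opKernel K t z.1 z.2) ^ 2
          ∂((volume : Measure ℝ).prod volume)) * ‖φ‖ ^ 2) := Real.sqrt_le_sqrt h2
    _ = _ := by
        rw [Real.sqrt_mul (integral_nonneg fun z => sq_nonneg _), Real.sqrt_sq (norm_nonneg _)]

/-- The measure of the square window, as a real number. -/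
theorem measureReal_window (t : ℝ) :
    (((volume : Measure ℝ).prod volume) (Ioo (-t) t ×ˢ Ioo (-t) t)).toReal = (max (2 * t) 0) ^ 2 := by
  rw [volume_prod_window, ENNReal.toReal_mul, ENNReal.toReal_ofReal', sq]

/-- Nested windows: the `L²` distance of the kernels is controlled by the area between the squares. -/
theorem integral_sq_opKernel_sub_le (hK : Continuous K) {t t' T M : ℝ} (htt' : t ≤ t') (ht'T : t' ≤ T)
    (hM : ∀ x ∈ Ioo (-T) T, ∀ y ∈ Ioo (-T) T, |K (x + y)| ≤ M) :
    ∫ z, (opKernel K t' z.1 z.2 - opKernel K t z.1 z.2) ^ 2 ∂((volume : Measure ℝ).prod volume)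
      ≤ M ^ 2 * ((max (2 * t') 0) ^ 2 - (max (2 * t) 0) ^ 2) := by
  set μ : Measure (ℝ × ℝ) := (volume : Measure ℝ).prod volume with hμ
  set S : Set (ℝ × ℝ) := Ioo (-t) t ×ˢ Ioo (-t) t with hS_def
  set S' : Set (ℝ × ℝ) := Ioo (-t') t' ×ˢ Ioo (-t') t' with hS'_def
  have hS : MeasurableSet S := measurableSet_Ioo.prod measurableSet_Ioo
  have hS' : MeasurableSet S' := measurableSet_Ioo.prod measurableSet_Ioo
  have hsub : S ⊆ S' := prod_mono (Ioo_subset_Ioo (neg_le_neg htt') htt') (Ioo_subset_Ioo (neg_le_neg htt') htt')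
  have hSfin : μ S ≠ ⊤ := by
    rw [hμ, hS_def, volume_prod_window]; exact ENNReal.mul_ne_top ENNReal.ofReal_ne_top ENNReal.ofReal_ne_top
  have hS'fin : μ S' ≠ ⊤ := by
    rw [hμ, hS'_def, volume_prod_window]; exact ENNReal.mul_ne_top ENNReal.ofReal_ne_top ENNReal.ofReal_ne_top
  -- pointwise domination
  have hpt : ∀ z : ℝ × ℝ, (opKernel K t' z.1 z.2 - opKernel K t z.1 z.2) ^ 2 ≤
      (S' \ S).indicator (fun _ => M ^ 2) z := by
    intro z
    by_cases hz' : z ∈ S'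
    · have hz'1 : z.1 ∈ Ioo (-t') t' := (mem_prod.mp hz').1
      have hz'2 : z.2 ∈ Ioo (-t') t' := (mem_prod.mp hz').2
      by_cases hz : z ∈ S
      · have hz1 : z.1 ∈ Ioo (-t) t := (mem_prod.mp hz).1
        have hz2 : z.2 ∈ Ioo (-t) t := (mem_prod.mp hz).2
        rw [opKernel_of_mem hz'1 hz'2, opKernel_of_mem hz1 hz2, sub_self,
          indicator_of_notMem (fun h => h.2 hz)]
        simp
      · rw [indicator_of_mem (show z ∈ S' \ S from ⟨hz', hz⟩), opKernel_of_mem hz'1 hz'2]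
        have hkz : opKernel K t z.1 z.2 = 0 := by
          rcases not_and_or.mp (fun h => hz (mem_prod.mpr h)) with h1 | h2
          · exact opKernel_of_not_mem_left h1
          · exact opKernel_of_not_mem_right h2
        rw [hkz, sub_zero, ← sq_abs]
        have hT1 : z.1 ∈ Ioo (-T) T := Ioo_subset_Ioo (neg_le_neg ht'T) ht'T hz'1
        have hT2 : z.2 ∈ Ioo (-T) T := Ioo_subset_Ioo (neg_le_neg ht'T) ht'T hz'2
        exact pow_le_pow_left₀ (abs_nonneg _) (hM _ hT1 _ hT2) 2
    · have hz : z ∉ S := fun h => hz' (hsub h)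
      have hk'z : opKernel K t' z.1 z.2 = 0 := by
        rcases not_and_or.mp (fun h => hz' (mem_prod.mpr h)) with h1 | h2
        · exact opKernel_of_not_mem_left h1
        · exact opKernel_of_not_mem_right h2
      have hkz : opKernel K t z.1 z.2 = 0 := by
        rcases not_and_or.mp (fun h => hz (mem_prod.mpr h)) with h1 | h2
        · exact opKernel_of_not_mem_left h1
        · exact opKernel_of_not_mem_right h2
      rw [hk'z, hkz, sub_self, indicator_of_notMem (fun h => hz' h.1)]
      simp
  have hint1 : Integrable (fun z : ℝ × ℝ => (opKernel K t' z.1 z.2 - opKernel K t z.1 z.2) ^ 2) μ :=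
    (memLp_opKernel_sub hK t t').integrable_sq
  have hint2 : Integrable ((S' \ S).indicator fun _ : ℝ × ℝ => M ^ 2) μ := by
    rw [integrable_indicator_iff (hS'.diff hS)]
    exact integrableOn_const ((measure_mono (fun z (hz : z ∈ S' \ S) => hz.1)).trans_lt hS'fin.lt_top).ne
  calc ∫ z, (opKernel K t' z.1 z.2 - opKernel K t z.1 z.2) ^ 2 ∂μ
      ≤ ∫ z, (S' \ S).indicator (fun _ => M ^ 2) z ∂μ := integral_mono hint1 hint2 hpt
    _ = μ.real (S' \ S) * M ^ 2 := by rw [integral_indicator_const _ (hS'.diff hS), smul_eq_mul]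
    _ = M ^ 2 * ((max (2 * t') 0) ^ 2 - (max (2 * t) 0) ^ 2) := by
        rw [mul_comm, measureReal_def, measure_sdiff hsub hS.nullMeasurableSet hSfin,
          ENNReal.toReal_sub_of_le (measure_mono hsub) hS'fin, ← measureReal_window t,
          ← measureReal_window t']

/-- **Operator-norm continuity of `t ↦ 𝖪[t]`.** -/
theorem continuous_op (hK : Continuous K) : Continuous (op hK) := by
  refine continuous_iff_continuousAt.2 fun t₀ => ?_
  obtain ⟨M, hM0, hM⟩ := exists_kernel_bound hK (|t₀| + 1)
  set g : ℝ → ℝ := fun t => (max (2 * t) 0) ^ 2 with hg_def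
  have hg : Continuous g := by
    simp only [hg_def]; fun_prop
  set B : ℝ → ℝ := fun t => Real.sqrt (M ^ 2 * |g t - g t₀|) with hB_def
  have hB : Tendsto B (𝓝 t₀) (𝓝 0) := by
    have hBc : Continuous B := by simp only [hB_def]; fun_prop
    have h0 : B t₀ = 0 := by simp [hB_def]
    simpa [h0] using hBc.tendsto t₀
  rw [ContinuousAt, tendsto_iff_norm_sub_tendsto_zero]
  refine squeeze_zero' (Eventually.of_forall fun t => norm_nonneg _) ?_ hB
  have hnear : ∀ᶠ t in 𝓝 t₀, |t - t₀| < 1 := by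
    have := Metric.ball_mem_nhds t₀ one_pos
    filter_upwards [this] with t ht
    rwa [Metric.mem_ball, Real.dist_eq] at ht
  filter_upwards [hnear] with t ht
  have ht₀T : t₀ ≤ |t₀| + 1 := (le_abs_self t₀).trans (le_add_of_nonneg_right zero_le_one)
  have htT : t ≤ |t₀| + 1 := by
    have := le_abs_self t₀; have := abs_lt.mp ht; linarith
  rcases le_total t t₀ with hle | hle
  · -- `t ≤ t₀`: the window grows from `t` to `t₀`
    rw [norm_sub_rev]
    refine (norm_op_sub_le hK t t₀).trans ?_
    refine Real.sqrt_le_sqrt ((integral_sq_opKernel_sub_le hK hle ht₀T hM).trans ?_)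
    refine mul_le_mul_of_nonneg_left ?_ (sq_nonneg _)
    rw [abs_sub_comm]; exact le_abs_self _
  · refine (norm_op_sub_le hK t₀ t).trans ?_
    refine Real.sqrt_le_sqrt ((integral_sq_opKernel_sub_le hK hle htT hM).trans ?_)
    exact mul_le_mul_of_nonneg_left (le_abs_self _) (sq_nonneg _)

end Summit.RiemannHypothesis.RiemannHypothesis.Theorems.SuzukiWindowsDoorOpPath

/-! ### The registered stub -/

namespace Summit.RiemannHypothesis.RiemannHypothesis.Cruxes.WindowsImplyContraction.Plumbing

open Summit.RiemannHypothesis.RiemannHypothesis.Theorems.SuzukiWindowsDoorOpPath in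
/-- **Registered stub `stub_opPath` of crux `WindowsImplyContraction`, LINE «plumbing» (PROVED; RH-FREE, ζ-free)**
— exact registered signature: for a continuous real kernel `K`, the truncated Hankel operators `𝖪[t]` form an
operator-norm-continuous path of compact self-adjoint operators on `Lp ℝ 2 volume` with `𝖪[0] = 0`, representing
`f ↦ 1_{(−t,t)} ∫_{(−t,t)} K(·+y) f(y) dy` a.e. (planner rh-dbr-theory g5, farm-verified; ported). -/
theorem stub_opPath :
    ∀ K : ℝ → ℝ, Continuous K →
      ∃ T : ℝ → (Lp ℝ 2 (volume : Measure ℝ) →L[ℝ] Lp ℝ 2 (volume : Measure ℝ)),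
        Continuous T ∧ T 0 = 0 ∧ (∀ t : ℝ, 0 ≤ t → IsSelfAdjoint (T t) ∧ IsCompactOperator (T t)) ∧
          (∀ t : ℝ, 0 ≤ t → ∀ f : Lp ℝ 2 (volume : Measure ℝ),
            ((T t f : Lp ℝ 2 (volume : Measure ℝ)) : ℝ → ℝ) =ᵐ[volume]
              fun x => (Ioo (-t) t).indicator (fun x => ∫ y in Ioo (-t) t, K (x + y) * f y) x) := by
  intro K hK
  exact ⟨op hK, continuous_op hK, op_zero hK,
    fun t _ => ⟨isSelfAdjoint_op hK t, isCompactOperator_op hK t⟩, fun t _ f => op_repr hK t f⟩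

end Summit.RiemannHypothesis.RiemannHypothesis.Cruxes.WindowsImplyContraction.Plumbing
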